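import Mathlib
import HarnessLib
import Literature.MathematicalPhysics.StatisticalMechanics.StepMeasureRegularisation
import Literature.MathematicalPhysics.StatisticalMechanics.WeightIntegrationMapABKM
import Literature.Probability.Distributions.GaussianLinearCompensation

/-!
# Dilations of the step measure, the `p`-th power of the Gaussian weights, and the zero-mode
# multiplier of the regularised covariance ([ABKM19] Lemma 8.4 (`ℓ = 1`) preparation, II)

Three pieces of bookkeeping for the Lipschitz dependence of the integration map
`R^{(q)}_{k+1}` on `q` ([ABKM19] Lemma 8.4 with `ℓ = 1`, obtained in this tree from the crude
Gaussian comparison `GaussianCovarianceComparisonEstimate` + Hölder):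

* **`stepMeasure_sq_mul`** — `μ(t²𝒞) = μ(𝒞) ∘ (t •)⁻¹`: the step measure of the dilated kernel
  is the dilated step measure (`N(0,S) ∘ (t•)⁻¹ = N(0,t²S)`), with the integral form
  **`integral_comp_smul_stepMeasure`** `∫ F(tζ) dμ_𝒞(ζ) = ∫ F dμ_{t²𝒞}`;
* **`weight_smul`**, **`midWeight_smul`** — `w(tφ) = w(φ)^{t²}` for the Gaussian weights
  `w_k^X`, `w_{k:k+1}^X` of [ABKM19] (7.4) (so the `p`-th power of a weight integral is a weight
  integral against the dilated measure: **`integral_weight_rpow_stepMeasure_eq`**);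
* `mulMat_zeroModeMul` (`c·𝟙𝟙ᵀ = mulMat (c M^d 1_{κ=0})`),
  **`circulant_add_constMat_eq_mulMat`**, **`posDef_circulant_add_constMat`** — the regularised
  covariance `circulant 𝒞 + c·𝟙𝟙ᵀ` of `StepMeasureRegularisation` is the multiplier matrix of
  `Re 𝒞̂ + c M^d 1_{κ=0}`, positive definite as soon as `Re 𝒞̂(κ) > 0` for `κ ≠ 0` and `c > 0`
  ("all operators are diagonal in Fourier space", [ABKM19] Remark 7.4).

Everything is proved; no named fact.

## References
* S. Adams, S. Buchholz, R. Kotecký, S. Müller, arXiv:1910.13564, Lemma 8.4, (6.23), Remark 7.4,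
  Ch. 7.1 (7.4) [AdamsBuchholzKoteckyMuller2019].
* S. Buchholz, J. Funct. Anal. 275 (2018), Thm 4.5 [Buchholz2016].
-/

noncomputable section

namespace Literature.MathematicalPhysics.StatisticalMechanics.GradientRG

open scoped BigOperators Matrix
open MeasureTheory ProbabilityTheory Finset WithLp
open Literature.MathematicalPhysics.StatisticalMechanics.GradientFRD (mulMat mulKernel mulSum fourierCoeff
  mulMat_add circulant_eq_mulMat posDef_mulMat re_fourierCoeff_zero_of_sum_eq_zero)
open Literature.Probability.Distributions (matrixCLM ofLp_matrixCLM multivariateGaussian_map_matrix)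

variable {d M : ℕ} [NeZero M]

/-! ## Dilations of the step measure -/

omit [NeZero M] in
/-- `circulant (t² 𝒞) = t² • circulant 𝒞` (bookkeeping). [cite: AdamsBuchholzKoteckyMuller2019, Ch. 4 (4.2)] -/
theorem circulant_const_mul (t : ℝ) (𝒞 : (Fin d → ZMod M) → ℝ) :
    Matrix.circulant (fun x => t * 𝒞 x) = t • Matrix.circulant 𝒞 := by
  ext i j
  simp [Matrix.circulant_apply]

/-- **Scaling of a centred Gaussian**: `N(0,S) ∘ (t•)⁻¹ = N(0, t²S)` for `S ⪰ 0`.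
[cite: Buchholz2016, Thm 4.5 (proof: change of variables)] -/
theorem multivariateGaussian_map_smul {ι : Type} [Fintype ι] [DecidableEq ι] {S : Matrix ι ι ℝ}
    (hS : S.PosSemidef) (t : ℝ) :
    (multivariateGaussian (0 : EuclideanSpace ℝ ι) S).map (fun x => t • x) =
      multivariateGaussian 0 (t ^ 2 • S) := by
  -- adapted from Literature/Probability/Distributions/GaussianInterpolationFormula (private lemma)
  have hfun : (fun x : EuclideanSpace ℝ ι => t • x) = matrixCLM (t • (1 : Matrix ι ι ℝ)) := by
    funext x
    apply (WithLp.ofLp_injective 2).eq_iff.mp ?_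
    rw [ofLp_matrixCLM, Matrix.smul_mulVec, Matrix.one_mulVec, WithLp.ofLp_smul]
  rw [hfun, multivariateGaussian_map_matrix hS]
  congr 1
  rw [Matrix.transpose_smul, Matrix.transpose_one, smul_mul_assoc, one_mul, Matrix.mul_smul,
    mul_one, smul_smul, pow_two]

/-- **`μ(t²𝒞) = μ(𝒞) ∘ (t•)⁻¹`**: the step measure of the dilated kernel is the dilated step
measure (`circulant 𝒞 ⪰ 0`). [cite: AdamsBuchholzKoteckyMuller2019, Lemma 8.4 (proof)] -/
theorem stepMeasure_sq_mul {𝒞 : (Fin d → ZMod M) → ℝ} (hC : (Matrix.circulant 𝒞).PosSemidef)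
    (t : ℝ) :
    stepMeasure (fun x => t ^ 2 * 𝒞 x) =
      (stepMeasure 𝒞).map (fun ζ : (Fin d → ZMod M) → ℝ => t • ζ) := by
  unfold stepMeasure
  rw [circulant_const_mul, ← multivariateGaussian_map_smul hC t,
    Measure.map_map (PiLp.continuous_ofLp 2 _).measurable (continuous_const_smul t).measurable,
    Measure.map_map (continuous_const_smul t).measurable (PiLp.continuous_ofLp 2 _).measurable]
  rfl

/-- **`∫ F(tζ) μ_𝒞(dζ) = ∫ F dμ_{t²𝒞}`** for every `F` (`t ≠ 0`, `circulant 𝒞 ⪰ 0`).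
[cite: AdamsBuchholzKoteckyMuller2019, Lemma 8.4 (proof)] -/
theorem integral_comp_smul_stepMeasure {𝒞 : (Fin d → ZMod M) → ℝ}
    (hC : (Matrix.circulant 𝒞).PosSemidef) {t : ℝ} (ht : t ≠ 0)
    {E : Type*} [NormedAddCommGroup E] [NormedSpace ℝ E] (F : ((Fin d → ZMod M) → ℝ) → E) :
    ∫ ζ, F (t • ζ) ∂(stepMeasure 𝒞) = ∫ ζ, F ζ ∂(stepMeasure (fun x => t ^ 2 * 𝒞 x)) := by
  rw [stepMeasure_sq_mul hC t]
  have he : MeasurableEmbedding (fun ζ : (Fin d → ZMod M) → ℝ => t • ζ) :=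
    (Homeomorph.smulOfNeZero t ht).measurableEmbedding
  rw [he.integral_map]

/-! ## The `p`-th power of the Gaussian weights -/

/-- **`w_k^X(tφ) = w_k^X(φ)^{t²}`** for the Gaussian weight `w_k^X = e^{½(φ, A_k^X φ)}`.
[cite: AdamsBuchholzKoteckyMuller2019, Ch. 7.1 (7.4)] -/
theorem weight_smul {Λ : Type*} [Fintype Λ] [DecidableEq Λ] (W : WeightData Λ) (k : ℕ)
    (X : Finset Λ) (t : ℝ) (φ : Λ → ℝ) :
    W.weight k X (t • φ) = W.weight k X φ ^ (t ^ 2) := by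
  unfold WeightData.weight
  rw [← Real.exp_mul, Matrix.mulVec_smul, dotProduct_smul, smul_dotProduct, smul_eq_mul,
    smul_eq_mul]
  congr 1; ring

/-- **`w_{k:k+1}^X(tφ) = w_{k:k+1}^X(φ)^{t²}`**. [cite: AdamsBuchholzKoteckyMuller2019, Ch. 7.1 (7.4)] -/
theorem midWeight_smul {Λ : Type*} [Fintype Λ] [DecidableEq Λ] (W : WeightData Λ) (k : ℕ)
    (X : Finset Λ) (t : ℝ) (φ : Λ → ℝ) :
    W.midWeight k X (t • φ) = W.midWeight k X φ ^ (t ^ 2) := by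
  unfold WeightData.midWeight
  rw [← Real.exp_mul, Matrix.mulVec_smul, dotProduct_smul, smul_dotProduct, smul_eq_mul,
    smul_eq_mul]
  congr 1; ring

/-- **The `p`-th power of a weight integral is a weight integral against the dilated step
measure**: `∫ w_k^X(φ+ζ)^p μ_𝒞(dζ) = ∫ w_k^X(√p φ + η) μ_{p𝒞}(dη)` (`p > 0`, `circulant 𝒞 ⪰ 0`).
[cite: AdamsBuchholzKoteckyMuller2019, Lemma 8.4 (proof)] -/
theorem integral_weight_rpow_stepMeasure_eq (W : WeightData (Fin d → ZMod M)) (k : ℕ)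
    (X : Finset (Fin d → ZMod M)) {𝒞 : (Fin d → ZMod M) → ℝ}
    (hC : (Matrix.circulant 𝒞).PosSemidef) {p : ℝ} (hp : 0 < p) (φ : (Fin d → ZMod M) → ℝ) :
    ∫ ζ, W.weight k X (φ + ζ) ^ p ∂(stepMeasure 𝒞) =
      ∫ η, W.weight k X (Real.sqrt p • φ + η) ∂(stepMeasure (fun x => p * 𝒞 x)) := by
  have hsq : Real.sqrt p ^ 2 = p := Real.sq_sqrt hp.le
  have ht : Real.sqrt p ≠ 0 := (Real.sqrt_pos.2 hp).ne'
  have h := integral_comp_smul_stepMeasure hC ht (fun ζ => W.weight k X (Real.sqrt p • φ + ζ))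
  rw [hsq] at h
  rw [← h]
  refine integral_congr_ae (Filter.Eventually.of_forall fun ζ => ?_)
  simp only []
  rw [← smul_add, weight_smul, hsq]

/-! ## The zero-mode multiplier and the regularised covariance as a multiplier matrix -/

/-! The multiplier of the constant covariance `c·𝟙𝟙ᵀ` is `κ ↦ c M^d 1_{κ = 0}`; it is written
out as the lambda `fun κ => if κ = 0 then c * M^d else 0` throughout (no new definition). -/

/-- The kernel of the zero-mode multiplier is the constant `c`. [cite: AdamsBuchholzKoteckyMuller2019, Ch. 6.1 (6.23)] -/
theorem mulKernel_zeroModeMul (c : ℝ) (x : Fin d → ZMod M) :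
    mulKernel (fun κ : Fin d → ZMod M => if κ = 0 then c * (M : ℝ) ^ d else 0) x = c := by
  unfold GradientFRD.mulKernel GradientFRD.mulSum
  have hM : ((M : ℂ) ^ d) ≠ 0 := pow_ne_zero _ (Nat.cast_ne_zero.2 (NeZero.ne M))
  rw [Finset.sum_eq_single (0 : Fin d → ZMod M) (fun κ _ hκ => by simp only [if_neg hκ]; simp)
    (fun h => (h (Finset.mem_univ _)).elim)]
  simp only [if_true, Literature.Probability.LatticeModels.torusChar_zero_left, mul_one]
  push_cast
  rw [mul_left_comm, inv_mul_cancel₀ hM, mul_one, Complex.ofReal_re]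

/-- **`c·𝟙𝟙ᵀ = mulMat (c M^d 1_{κ=0})`**: the constant covariance is the multiplier matrix of the
zero mode. [cite: AdamsBuchholzKoteckyMuller2019, Ch. 6.1 (6.23)] -/
theorem mulMat_zeroModeMul (c : ℝ) :
    mulMat (fun κ : Fin d → ZMod M => if κ = 0 then c * (M : ℝ) ^ d else 0) = constMat c := by
  ext i j
  simp only [GradientFRD.mulMat, Matrix.circulant_apply, mulKernel_zeroModeMul, constMat,
    Matrix.of_apply]

/-- **The regularised covariance is a multiplier matrix**: for an even kernel `𝒞`,
`circulant 𝒞 + c·𝟙𝟙ᵀ = mulMat (Re 𝒞̂ + c M^d 1_{κ=0})`. [cite: AdamsBuchholzKoteckyMuller2019, Remark 7.4] -/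
theorem circulant_add_constMat_eq_mulMat {𝒞 : (Fin d → ZMod M) → ℝ} (heven : ∀ x, 𝒞 (-x) = 𝒞 x)
    (c : ℝ) :
    Matrix.circulant 𝒞 + constMat c =
      mulMat (fun κ => (fourierCoeff 𝒞 κ).re + if κ = 0 then c * (M : ℝ) ^ d else 0) := by
  rw [mulMat_add, mulMat_zeroModeMul, circulant_eq_mulMat heven]

/-- The regularised multiplier `Re 𝒞̂ + c M^d 1_{κ=0}` is even for an even kernel.
[cite: AdamsBuchholzKoteckyMuller2019, Remark 7.4] -/
theorem re_fourierCoeff_add_zeroModeMul_neg {𝒞 : (Fin d → ZMod M) → ℝ} (heven : ∀ x, 𝒞 (-x) = 𝒞 x)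
    (c : ℝ) (κ : Fin d → ZMod M) :
    ((fourierCoeff 𝒞 (-κ)).re + if -κ = 0 then c * (M : ℝ) ^ d else 0) =
      (fourierCoeff 𝒞 κ).re + if κ = 0 then c * (M : ℝ) ^ d else 0 := by
  rw [GradientFRD.re_fourierCoeff_neg_of_even heven]
  simp only [neg_eq_zero]

/-- The regularised multiplier is positive mode by mode when `Re 𝒞̂(κ) > 0` for `κ ≠ 0`,
`Re 𝒞̂(0) ≥ 0` and `c > 0`. [cite: AdamsBuchholzKoteckyMuller2019, Remark 7.4] -/
theorem re_fourierCoeff_add_zeroModeMul_pos {𝒞 : (Fin d → ZMod M) → ℝ}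
    (hpos : ∀ κ, κ ≠ 0 → 0 < (fourierCoeff 𝒞 κ).re) (h0 : 0 ≤ (fourierCoeff 𝒞 0).re)
    {c : ℝ} (hc : 0 < c) (κ : Fin d → ZMod M) :
    0 < (fourierCoeff 𝒞 κ).re + (if κ = 0 then c * (M : ℝ) ^ d else 0) := by
  by_cases hκ : κ = 0
  · rw [if_pos hκ, hκ]
    have hM : (0 : ℝ) < (M : ℝ) ^ d := pow_pos (Nat.cast_pos.2 (Nat.pos_of_ne_zero (NeZero.ne M))) d
    exact add_pos_of_nonneg_of_pos h0 (mul_pos hc hM)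
  · rw [if_neg hκ, add_zero]; exact hpos κ hκ

/-- **`circulant 𝒞 + c·𝟙𝟙ᵀ ≻ 0`** for an even zero-sum kernel with `Re 𝒞̂(κ) > 0` for all `κ ≠ 0`
and `c > 0`: the zero-mode regularisation of a degenerate fluctuation covariance is positive
DEFINITE. [cite: AdamsBuchholzKoteckyMuller2019, Ch. 6.1 (6.23) / Remark 7.4] -/
theorem posDef_circulant_add_constMat {𝒞 : (Fin d → ZMod M) → ℝ} (heven : ∀ x, 𝒞 (-x) = 𝒞 x)
    (hpos : ∀ κ, κ ≠ 0 → 0 < (fourierCoeff 𝒞 κ).re) (h0 : 0 ≤ (fourierCoeff 𝒞 0).re)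
    {c : ℝ} (hc : 0 < c) :
    (Matrix.circulant 𝒞 + constMat c).PosDef := by
  rw [circulant_add_constMat_eq_mulMat heven]
  exact posDef_mulMat (re_fourierCoeff_add_zeroModeMul_pos hpos h0 hc)

/-- For a zero-sum kernel `Re 𝒞̂(0) = 0 ≥ 0` (the form in which the hypothesis `h0` is met).
[cite: Buchholz2016, §1 (1.5)] -/
theorem re_fourierCoeff_zero_nonneg_of_sum_eq_zero {𝒞 : (Fin d → ZMod M) → ℝ} (h : ∑ x, 𝒞 x = 0) :
    0 ≤ (fourierCoeff 𝒞 0).re :=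
  (re_fourierCoeff_zero_of_sum_eq_zero h).symm.le

end Literature.MathematicalPhysics.StatisticalMechanics.GradientRG

end
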